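/-
Copyright (c) 2026 the pub-hodgecm-mathlib formalisation cell (harness21).  Prover seat hodgecm-mathlib-LH4-p14 (g9) (L1 valve hand; LEAD F0P6-plan (g16) BATCH #280 (2),
(dec-2-pay) F2, sub-brick F2θ), Track B «K2-LIT» ∕ hLiu418 #184♮, socket #41 KIND 1, package (K1b-♮): THE LEVI∕PHASE FACTOR OF THE ADAPTED-FRAME READING IS A SCALAR —
step (6) of the presentation blueprint `F0/P3c/LH4/LH4-p14/g9/BLUEPRINT-F2-presentation.v1.LH4p14g9.md` (over ★ p865320 F2β ∕ ★ p865405 F2δ ∕ ★ `K2LiuKindOneLineCornerArchReading`).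
THEOREMS ONLY (no `def`, no `instance`, no notation, no named-fact hypothesis, no `sorry`, default heartbeats).
-/
import Summits.HodgeConjecture.HodgeConjecture.Theorems.K2LiuKindOneLineCornerArchReading     -- ★ `corner_mul`, `corner_mem`, `corner_toBlocks₁₁_det`, `corner_toBlocks₂₁_eq_zero` (brings `IsArchSiegelSection`)
import Summits.HodgeConjecture.HodgeConjecture.Theorems.K2LiuKindOneLineCornerFrameWeylUnip    -- ★ p865405 F2δ (this seat): `slot_letters_of_ne_zero` (brings ★ F2β)
import HarnessLib

/-!
# Crux `HLiu418`, socket #41, KIND 1 (K1-b♮), (dec-2-pay) F2θ — `K2LiuKindOneLineCornerLeviPeel`: THE ADAPTED FRAME'S LEVI∕PHASE FACTOR PEELS OFF AS A SCALAR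

Cell `hodgecm-mathlib`, hLiu418 = `stmt-HodgeConjecture-24832` (helper lane, count-neutral); squad K2 ∕ K2Liu, socket #41, KIND 1.  ★ F2δ
`K2LiuKindOneLineCornerFrameWeylUnip.frame_archAt_blkD_weyl_unip_adapted` reads the line's `w_Δ·u` in the Levi-ADAPTED frame as `ι(m(cτ′, cτ) · J₁ · n₁(2cτ′x))`; the
`hchain₁` letter of ★ p865283 wants the archimedean integrand in the literal shape `Finf i σ s (ι(J₁·n₁ t) · G)`.  THIS FILE removes the Levi∕phase factor
`m(cτ′, cτ) = diag(cτ′, cτ)`: it is a Siegel–Levi element of `U(J)` through the corner (`conj(cτ′)·cτ = 1` since `c·c = −1`, `conj c = −c`, `ττ′ = 1`), so for every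
archimedean Siegel section `F` (`IsArchSiegelSection χ s F`, ★ `K2LiuArchInducedTubeDefs`) it peels off as the scalar `χ(cτ′)·‖cτ′‖^{2s+2}`:
* §1 `cornerLevi_mem` (`conj a · b = 1 ⇒ m(a,b)ᴴ J₁ m(a,b) = J₁`), **`corner_leviSlot_peel`** — `F(ι(m(a,b)·X)·G) = χ(a)·‖a‖^{2s+2}·F(ι(X)·G)` for `conj a · b = 1`
  (★ `corner_mul`, ★ `corner_mem`, ★ `corner_toBlocks₂₁_eq_zero`, ★ `corner_toBlocks₁₁_det`, the section law);
* §2 the F2δ letters: `adaptedSlot_conj_mul` (`conj(cτ′)·(cτ) = 1` for `c = i·sgn t`, `τ = ρρ`, `τ′ = ρ′ρ′`, `t ≠ 0`), `norm_adaptedSlot` (`‖cτ′‖ = ρ′ρ′`), and the HEAD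
  **`corner_adaptedWeylUnip_peel`** — `F(ι(m(cτ′,cτ)·J₁·n(X))·G) = χ(cτ′)·‖cτ′‖^{2s+2}·F(ι(J₁·n(X))·G)` in exactly ★ F2δ's output letters, any `1 × 1` block `X`.
[Shimura1997, §16, §18.1 (18.4)] [KudlaRallis1994, §2] [HarrisKudlaSweet1996, §1 (1.11)].
HONEST LABEL.  Count-neutral helper; closes no socket: `HC_CM` is proved only modulo the 7 printed citations (2 remaining named inputs: hLiu418 = `stmt-HodgeConjecture-24832`,
h413 = `stmt-HodgeConjecture-24833`) until rung 0 closes.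

## References
* [Shimura1997] G. Shimura, *Euler Products and Eisenstein Series*, CBMS 93 (1997), §16, §18.1 (18.4).  [KudlaRallis1994] S. Kudla, S. Rallis, Ann. of Math. 140 (1994), §2.
* [HarrisKudlaSweet1996] M. Harris, S. Kudla, W. Sweet, J. AMS 9 (1996), §1 (1.11).
-/

set_option autoImplicit false
set_option linter.dupNamespace false -- the mandated namespace repeats `HodgeConjecture.HodgeConjecture`

noncomputable section

open scoped Matrix ComplexConjugate
open Complex Matrix NumberField

namespace Summit.HodgeConjecture.HodgeConjecture.Cruxes.HLiu418.K2LiuKindOneLineCornerLeviPeel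

open K2LiuArchInducedTubeDefs (IsArchSiegelSection)
open K2LiuKindOneLineCornerArchReading (corner_mul corner_mem corner_toBlocks₁₁_det corner_toBlocks₂₁_eq_zero)
open K2LiuKindOneLineCornerFrameReading (slot_letters)

variable (ι : Matrix (Fin 1 ⊕ Fin 1) (Fin 1 ⊕ Fin 1) ℂ → Matrix (Fin 2 ⊕ Fin 2) (Fin 2 ⊕ Fin 2) ℂ)
    (hι : ∀ x, ι x = fromBlocks !![1, 0; 0, x (Sum.inl 0) (Sum.inl 0)] !![0, 0; 0, x (Sum.inl 0) (Sum.inr 0)] !![0, 0; 0, x (Sum.inr 0) (Sum.inl 0)] !![1, 0; 0, x (Sum.inr 0) (Sum.inr 0)])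

/-! ## §1 A line Levi element `m(a, b)`, `conj a · b = 1`, through the corner is a Siegel–Levi element of `U(J)` and peels off as a scalar -/

/-- `m(a,b) = diag(a, b)` with `conj a · b = 1` preserves `J₁`: `m(a,b)ᴴ · J₁ · m(a,b) = J₁`. [cite: Shimura1997, §16] -/
theorem cornerLevi_mem {a b : ℂ} (hab : conj a * b = 1) :
    (fromBlocks !![a] 0 0 !![b] : Matrix (Fin 1 ⊕ Fin 1) (Fin 1 ⊕ Fin 1) ℂ)ᴴ * Matrix.J (Fin 1) ℂ * fromBlocks !![a] 0 0 !![b] = Matrix.J (Fin 1) ℂ := by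
  have hba : conj b * a = 1 := by
    have h := congrArg conj hab
    rw [map_mul, starRingEnd_self_apply, map_one] at h
    rw [mul_comm]; exact h
  rw [Matrix.J]
  ext i j
  rcases i with i | i <;> rcases j with j | j <;> fin_cases i <;> fin_cases j <;>
    simp [Matrix.mul_apply, Fintype.sum_sum_type, fromBlocks, conjTranspose_apply, hab, hba]

include hι in
/-- **THE CORNER LEVI PEELS OFF AS A SCALAR**: for an archimedean Siegel section `F ∈ I(s, χ)` (tube frame, `U(2,2)`), `conj a · b = 1`, any `X` and `G`,
`F(ι(m(a,b)·X)·G) = χ(a)·‖a‖^{2s+2}·F(ι(X)·G)` — `ι(m(a,b)) = m_J(diag(1,a))` lies in the Siegel parabolic of `U(J)` with Levi block `diag(1,a)`, `det = a`.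
[cite: Shimura1997, §16] [cite: KudlaRallis1994, §2] -/
theorem corner_leviSlot_peel {χ : ℂ → ℂ} {s : ℂ} {F : Matrix (Fin 2 ⊕ Fin 2) (Fin 2 ⊕ Fin 2) ℂ → ℂ} (hF : IsArchSiegelSection χ s F)
    {a b : ℂ} (hab : conj a * b = 1) (X : Matrix (Fin 1 ⊕ Fin 1) (Fin 1 ⊕ Fin 1) ℂ) (G : Matrix (Fin 2 ⊕ Fin 2) (Fin 2 ⊕ Fin 2) ℂ) :
    F (ι (fromBlocks !![a] 0 0 !![b] * X) * G) = χ a * (((‖a‖ : ℝ) : ℂ) ^ (2 * s + 2)) * F (ι X * G) := by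
  have h21 : (fromBlocks !![a] 0 0 !![b] : Matrix (Fin 1 ⊕ Fin 1) (Fin 1 ⊕ Fin 1) ℂ).toBlocks₂₁ = 0 := toBlocks_fromBlocks₂₁ _ _ _ _
  have hdet : (ι (fromBlocks !![a] 0 0 !![b])).toBlocks₁₁.det = a := by
    rw [corner_toBlocks₁₁_det ι hι, toBlocks_fromBlocks₁₁, Matrix.det_fin_one]
    rfl
  rw [corner_mul ι hι, Matrix.mul_assoc, hF _ _ (corner_mem ι hι (cornerLevi_mem hab)) (corner_toBlocks₂₁_eq_zero ι hι h21), hdet]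
  simp only [Fintype.card_fin, Nat.cast_ofNat]

/-! ## §2 The letters of the adapted slot: `conj(cτ′)·cτ = 1`, `‖cτ′‖ = τ′`, and the head in ★ F2δ's output shape -/

/-- the adapted slot letters are a unitary-Levi pair: `conj(c·τ′) · (c·τ) = 1` for `c = i·(t∕|t|)`, `τ = ρρ`, `τ′ = ρ′ρ′` (`ρ = √(|t|∕2)`, `ρ′ = ρ⁻¹`, `t ≠ 0`).
[folklore] -/
theorem adaptedSlot_conj_mul {t : ℝ} (ht : t ≠ 0) :
    conj (I * ((t / |t| : ℝ) : ℂ) * ((((Real.sqrt (|t| / 2))⁻¹ : ℝ) : ℂ) * (((Real.sqrt (|t| / 2))⁻¹ : ℝ) : ℂ))) *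
      (I * ((t / |t| : ℝ) : ℂ) * ((Real.sqrt (|t| / 2) : ℂ) * (Real.sqrt (|t| / 2) : ℂ))) = 1 := by
  obtain ⟨hc, hτ⟩ := K2LiuKindOneLineCornerFrameWeylUnip.slot_letters_of_ne_zero ht
  rw [map_mul, map_mul, map_mul, Complex.conj_I, Complex.conj_ofReal, Complex.conj_ofReal]
  linear_combination (-(((((Real.sqrt (|t| / 2))⁻¹ : ℝ) : ℂ) * (((Real.sqrt (|t| / 2))⁻¹ : ℝ) : ℂ)) *
      ((Real.sqrt (|t| / 2) : ℂ) * (Real.sqrt (|t| / 2) : ℂ)))) * hc + hτ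

/-- `‖c·τ′‖ = ρ′ρ′` (`|c| = 1`). [folklore] -/
theorem norm_adaptedSlot {t : ℝ} (ht : t ≠ 0) :
    ‖I * ((t / |t| : ℝ) : ℂ) * ((((Real.sqrt (|t| / 2))⁻¹ : ℝ) : ℂ) * (((Real.sqrt (|t| / 2))⁻¹ : ℝ) : ℂ))‖ = (Real.sqrt (|t| / 2))⁻¹ * (Real.sqrt (|t| / 2))⁻¹ := by
  have hs : abs (t / |t|) = 1 := by
    rw [abs_div, abs_abs, div_self (abs_ne_zero.2 ht)]
  have hρ : 0 ≤ (Real.sqrt (|t| / 2))⁻¹ := inv_nonneg.2 (Real.sqrt_nonneg _)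
  rw [norm_mul, norm_mul, Complex.norm_I, one_mul, Complex.norm_real, Real.norm_eq_abs, hs, one_mul, ← ofReal_mul, Complex.norm_real,
    Real.norm_eq_abs, abs_of_nonneg (mul_nonneg hρ hρ)]

include hι in
/-- **HEAD — THE ADAPTED FRAME'S LEVI∕PHASE FACTOR PEELS OFF** (★ F2δ's output letters): for `F ∈ I(s, χ)` archimedean (tube frame), `t ≠ 0` the slot letter, any `1 × 1`
block `X` and any `G`, `F(ι(m(cτ′, cτ) · J₁ · n(X)) · G) = χ(cτ′) · ‖cτ′‖^{2s+2} · F(ι(J₁ · n(X)) · G)` with `c = i·(t∕|t|)`, `τ = ρρ`, `τ′ = ρ′ρ′` — so after ★ F2δ the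
archimedean integrand of the pulled-back line family is `Finf(ι(J₁·n(X))·G)` times a constant of modulus `(ρ′ρ′)^{2 re s + 2}` (`|χ| ≤ 1`).
[cite: Shimura1997, §16, §18.1 (18.4)] [cite: KudlaRallis1994, §2] [cite: HarrisKudlaSweet1996, §1 (1.11)] -/
theorem corner_adaptedWeylUnip_peel {χ : ℂ → ℂ} {s : ℂ} {F : Matrix (Fin 2 ⊕ Fin 2) (Fin 2 ⊕ Fin 2) ℂ → ℂ} (hF : IsArchSiegelSection χ s F)
    {t : ℝ} (ht : t ≠ 0) (X : Matrix (Fin 1) (Fin 1) ℂ) (G : Matrix (Fin 2 ⊕ Fin 2) (Fin 2 ⊕ Fin 2) ℂ) :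
    F (ι (fromBlocks !![I * ((t / |t| : ℝ) : ℂ) * ((((Real.sqrt (|t| / 2))⁻¹ : ℝ) : ℂ) * (((Real.sqrt (|t| / 2))⁻¹ : ℝ) : ℂ))] 0 0
            !![I * ((t / |t| : ℝ) : ℂ) * ((Real.sqrt (|t| / 2) : ℂ) * (Real.sqrt (|t| / 2) : ℂ))] *
          Matrix.J (Fin 1) ℂ * fromBlocks 1 X 0 1) * G) =
      χ (I * ((t / |t| : ℝ) : ℂ) * ((((Real.sqrt (|t| / 2))⁻¹ : ℝ) : ℂ) * (((Real.sqrt (|t| / 2))⁻¹ : ℝ) : ℂ))) *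
        ((((Real.sqrt (|t| / 2))⁻¹ * (Real.sqrt (|t| / 2))⁻¹ : ℝ) : ℂ) ^ (2 * s + 2)) * F (ι (Matrix.J (Fin 1) ℂ * fromBlocks 1 X 0 1) * G) := by
  rw [Matrix.mul_assoc (fromBlocks _ _ _ _) (Matrix.J (Fin 1) ℂ), corner_leviSlot_peel ι hι hF (adaptedSlot_conj_mul ht), norm_adaptedSlot ht]

end Summit.HodgeConjecture.HodgeConjecture.Cruxes.HLiu418.K2LiuKindOneLineCornerLeviPeel

end
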